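import Summits.FinalStateConjecture.FinalStateConjecture.Theorems.EIHFluxBalanceInertialRecessionStubRechart3Coverage
import Summits.FinalStateConjecture.FinalStateConjecture.Theorems.EIHFluxBalanceInertialRecessionRechartCarterRaise
import Summits.FinalStateConjecture.FinalStateConjecture.Theorems.EIHFluxBalanceInertialRecessionRechartTiltEnvelope

/-!
# Route EIHFluxBalance — `InertialRecession`, re-charting: the REST-FRAME DICTIONARIES of a clock chart
# (the hypotheses `hcov`, `hlab` of the transfer …RechartTransfer3) and its clock/slack package

Helper file for the crux `stmt-FinalStateConjecture-10166`
(`Summit.FinalStateConjecture.FinalStateConjecture.Theses.EIHFluxBalance.InertialRecession`),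
stub `stub_rechart` (the transfer P2 of line `sublinear-is-free-clean-window-charges`), part G2.

For the re-charting map `A = honestChart Λ̃ ξ T₀ ∘ C` of `clockChart_package` (clauses: `A` injective,
`A = honestChart` near late points of bounded offset, `‖(C y)~‖ ≤ ‖ỹ‖`):
* `coverage_dictionary` — every late lab point of painted radius `≤ R` is `A z` with EXACT model
  radius, `|z⁰ − θ(x⁰)| ≤ √(ũ⁰(T₀ z⁰)² − 1)·(r + |a|)` for the lab clock `θ = T₀⁻¹`, and
  `|T₀ z⁰ − x⁰| ≤ γ (r + |a|)` (from `coverage_of_honest`, `abs_modelTime_sub_clock_le`);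
* `lab_dictionary` — a chart point `A z` of bounded model offset and late LAB time is an honest chart
  point with painted radius `r_a(z)` (coverage + injectivity; no clamp internals);
* `exists_labClock_package` — the lab clock `θ` with its calculus (inverse, monotone, `1`-Lipschitz,
  continuous, `→ ∞`, slack rate `1 − (ũ⁰)⁻¹`);
* `frameVel_zero_facts` — `1 ≤ ũ⁰ ≤ γ`, `ũ⁰` differentiable with an eventual `1`-Lipschitz bound.
[folklore]
-/

noncomputable section

set_option linter.dupNamespace false

open Set Filter Topology Function Literature.Geometry.Lorentzian
open Summit.FinalStateConjecture.FinalStateConjecture.Theorems.SublinearIsFree.Rechart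
open scoped ContDiff

namespace Summit.FinalStateConjecture.FinalStateConjecture.Theorems

/-- `√(u² − 1) ≤ γ` for `|u| ≤ γ`. [folklore] -/
theorem sqrt_sq_sub_one_le_of_abs_le {u γ : ℝ} (h : |u| ≤ γ) : Real.sqrt (u ^ 2 - 1) ≤ γ := by
  have hγ : 0 ≤ γ := (abs_nonneg u).trans h
  rw [Real.sqrt_le_left hγ]
  have : u ^ 2 ≤ γ ^ 2 := by rw [← sq_abs u]; exact pow_le_pow_left₀ (abs_nonneg u) h 2
  linarith

section Dictionaries

variable (Λ : ℝ → lorentzGroup) (ξ : ℝ → E3) (T₀ : ℝ → ℝ)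
  (hΛ : ContDiff ℝ ∞ (fun t ↦ ((Λ t : E4 ≃L[ℝ] E4) : E4 →L[ℝ] E4)))
  (hT₀ : ContDiff ℝ ∞ T₀) {γ : ℝ} (hγ1 : 1 ≤ γ) (huγ : ∀ t, |((Λ t : E4 ≃L[ℝ] E4) (E4.basisVector 0)) 0| ≤ γ)
  (hT₀lo : ∀ σ τ, σ ≤ τ → τ - σ ≤ T₀ τ - T₀ σ) (a : ℝ)
  {A C : E4 → E4} (hhon : ∀ K : ℝ, ∃ τK : ℝ, ∀ y : E4, τK ≤ y 0 → ‖E4.spatial y‖ ≤ K →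
    A =ᶠ[𝓝 y] honestChart Λ ξ T₀)
  (hAinj : Injective A) (hAC : ∀ y, A y = honestChart Λ ξ T₀ (C y))
  (hCle : ∀ y, ‖E4.spatial (C y)‖ ≤ ‖E4.spatial y‖)
  {θ : ℝ → ℝ} (hθT : ∀ τ, θ (T₀ τ) = τ) (hθm : Monotone θ)
  (hθ1 : ∀ t t', t' ≤ t → θ t - θ t' ≤ t - t')

include hΛ hT₀ hγ1 huγ hT₀lo hhon hθT hθm hθ1 in
/-- **Coverage dictionary** (the hypothesis `hcov` of the transfer in the rest frame). [folklore] -/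
theorem coverage_dictionary (R : ℝ) : ∃ tR : ℝ, ∀ x : E4, tR ≤ x 0 →
    Kerr.radius a (poincareInv (Λ (x 0)) (E4.ofTimeSpace (x 0) (ξ (x 0))) x) ≤ R →
    ∃ z : E4, A z = x ∧
      Kerr.radius a z = Kerr.radius a (poincareInv (Λ (x 0)) (E4.ofTimeSpace (x 0) (ξ (x 0))) x) ∧
      |z 0 - θ (x 0)| ≤ Real.sqrt ((((Λ (T₀ (z 0)) : E4 ≃L[ℝ] E4) (E4.basisVector 0)) 0) ^ 2 - 1) *
        (Kerr.radius a z + |a|) ∧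
      |T₀ (z 0) - x 0| ≤ γ * (Kerr.radius a z + |a|) := by
  obtain ⟨tR, htR⟩ := coverage_of_honest Λ ξ T₀ hΛ hT₀ hγ1 huγ hT₀lo a hhon R
  refine ⟨tR, fun x hx hxR ↦ ?_⟩
  obtain ⟨z, hAz, hhz, hrz, -, -⟩ := htR x hx hxR
  have hoff : ‖E4.spatial z‖ ≤ Kerr.radius a z + |a| := spatialNorm_le_radius_add_abs a z
  have hsq0 : 0 ≤ Real.sqrt ((((Λ (T₀ (z 0)) : E4 ≃L[ℝ] E4) (E4.basisVector 0)) 0) ^ 2 - 1) :=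
    Real.sqrt_nonneg _
  refine ⟨z, hAz, hrz, ?_, ?_⟩
  · have h := abs_modelTime_sub_clock_le Λ ξ T₀ hθT hθm hθ1 z
    rw [hhz] at h
    exact h.trans (mul_le_mul_of_nonneg_left hoff hsq0)
  · have h := abs_clock_sub_labTime_le Λ ξ T₀ z
    rw [hhz] at h
    refine h.trans ((mul_le_mul_of_nonneg_left hoff hsq0).trans
      (mul_le_mul_of_nonneg_right (sqrt_sq_sub_one_le_of_abs_le (huγ _))
        (add_nonneg (Kerr.radius_nonneg a z) (abs_nonneg a))))

include hΛ hT₀ hγ1 huγ hT₀lo hhon hAinj hAC hCle in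
/-- **Lab dictionary** (the hypothesis `hlab` of the transfer in the rest frame): a chart point `A z`
with model offset `‖z̃‖ ≤ K` and lab time `≥ tK` is the honest chart point of `z`, and its painted
radius is `r_a(z)`. [folklore] -/
theorem lab_dictionary (K : ℝ) : ∃ tK : ℝ, ∀ z : E4, tK ≤ A z 0 → ‖E4.spatial z‖ ≤ K →
    honestChart Λ ξ T₀ z = A z ∧
      Kerr.radius a z = Kerr.radius a (poincareInv (Λ (A z 0)) (E4.ofTimeSpace (A z 0) (ξ (A z 0))) (A z)) := by
  obtain ⟨tK, htK⟩ := coverage_of_honest Λ ξ T₀ hΛ hT₀ hγ1 huγ hT₀lo a hhon K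
  refine ⟨tK, fun z hz hzK ↦ ?_⟩
  -- the painted radius of `A z = honestChart (C z)` is `r_a(C z) ≤ ‖(C z)~‖ ≤ ‖z̃‖ ≤ K`
  have hprad : Kerr.radius a (poincareInv (Λ (A z 0)) (E4.ofTimeSpace (A z 0) (ξ (A z 0))) (A z)) =
      Kerr.radius a (C z) := by
    rw [hAC z, honestChart_apply_zero, radius_poincareInv_honestChart]
  have hle : Kerr.radius a (poincareInv (Λ (A z 0)) (E4.ofTimeSpace (A z 0) (ξ (A z 0))) (A z)) ≤ K := by
    rw [hprad]
    exact (Kerr.radius_le_spatialNorm a (C z)).trans ((hCle z).trans hzK)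
  obtain ⟨y, hAy, hhy, hry, -, -⟩ := htK (A z) hz hle
  have hyz : y = z := hAinj hAy
  subst hyz
  exact ⟨hhy, hry⟩

end Dictionaries

/-! ### The lab clock and the slack of a package clock -/

section Clock

variable (Λ : ℝ → lorentzGroup) (T₀ : ℝ → ℝ) {γ : ℝ}
  (hclock : ∀ τ, HasDerivAt T₀ (frameVel (Λ (T₀ τ)) 0) τ)
  (hT₀lo : ∀ σ τ, σ ≤ τ → τ - σ ≤ T₀ τ - T₀ σ) (hT₀hi : ∀ σ τ, σ ≤ τ → T₀ τ - T₀ σ ≤ γ * (τ - σ))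
  (hpos : ∀ t, 0 < ((Λ t : E4 ≃L[ℝ] E4) (E4.basisVector 0)) 0)

include hclock hT₀lo hT₀hi hpos in
/-- **The lab-clock package** of a package clock: the inverse clock `θ` (`θ ∘ T₀ = id`, `T₀ ∘ θ = id`),
monotone, `1`-Lipschitz, continuous, tending to `∞`, and the slack rate
`(t − θ t)' = 1 − (ũ⁰ t)⁻¹`. [folklore] -/
theorem exists_labClock_package :
    ∃ θ : ℝ → ℝ, (∀ τ, θ (T₀ τ) = τ) ∧ (∀ t, T₀ (θ t) = t) ∧ Monotone θ ∧
      (∀ t t', t' ≤ t → θ t - θ t' ≤ t - t') ∧ Continuous θ ∧ Tendsto θ atTop atTop ∧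
      ∀ t, HasDerivAt (fun t ↦ t - θ t) (1 - (((Λ t : E4 ≃L[ℝ] E4) (E4.basisVector 0)) 0)⁻¹) t := by
  obtain ⟨θ, hθT, hTθ, hθm, hθ1, -⟩ := exists_labClock hT₀lo hT₀hi
  have hθc : Continuous θ := by
    refine (LipschitzWith.of_dist_le_mul (K := 1) fun t t' ↦ ?_).continuous
    rw [NNReal.coe_one, one_mul, Real.dist_eq, Real.dist_eq]
    exact one_lipschitz_abs_rechart hθm hθ1 t t'
  have hγ : 0 < γ := by have h1 := hT₀lo 0 1 zero_le_one; have h2 := hT₀hi 0 1 zero_le_one; linarith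
  have hθtop : Tendsto θ atTop atTop := by
    -- `θ t ≥ (t − T₀ 0)/γ` for `t ≥ T₀ 0`
    refine tendsto_atTop_atTop.mpr fun b ↦ ⟨T₀ 0 + γ * |b|, fun t ht ↦ ?_⟩
    have hθ0 : θ (T₀ 0) = 0 := hθT 0
    have hmono : (0 : ℝ) ≤ θ t := by
      rw [← hθ0]; exact hθm (by have := abs_nonneg b; nlinarith)
    have h := hT₀hi 0 (θ t) hmono
    rw [hTθ, sub_zero] at h
    have : γ * |b| ≤ γ * θ t := by linarith
    have := le_of_mul_le_mul_left this hγ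
    linarith [le_abs_self b]
  have hu1 : ∀ t, 1 ≤ frameVel (Λ t) 0 := fun t ↦ by
    have h := one_le_abs_lorentz_apply_zero (Λ t)
    rw [abs_of_pos (hpos t)] at h; exact h
  refine ⟨θ, hθT, hTθ, hθm, hθ1, hθc, hθtop, fun t ↦ ?_⟩
  exact hasDerivAt_slack (u0 := fun t ↦ frameVel (Λ t) 0) hclock hu1 hθc hTθ t

end Clock

/-! ### The Lorentz factor as a function of lab time -/

/-- **Facts about `ũ⁰`**: `1 ≤ ũ⁰ ≤ γ`, differentiable, and eventually `1`-Lipschitz when the first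
derivative of the frame decays. [folklore] -/
theorem frameVel_zero_facts (Λ : ℝ → lorentzGroup)
    (hΛ : ContDiff ℝ ∞ (fun t ↦ ((Λ t : E4 ≃L[ℝ] E4) : E4 →L[ℝ] E4))) {γ : ℝ}
    (huγ : ∀ t, |((Λ t : E4 ≃L[ℝ] E4) (E4.basisVector 0)) 0| ≤ γ)
    (hpos : ∀ t, 0 < ((Λ t : E4 ≃L[ℝ] E4) (E4.basisVector 0)) 0)
    (hdec : ∀ m, 1 ≤ m → m ≤ 3 → Tendsto (fun t ↦ iteratedDeriv m
      (fun s ↦ ((Λ s : E4 ≃L[ℝ] E4) : E4 →L[ℝ] E4)) t) atTop (𝓝 0)) :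
    (∀ t, 1 ≤ ((Λ t : E4 ≃L[ℝ] E4) (E4.basisVector 0)) 0) ∧
      (∀ t, ((Λ t : E4 ≃L[ℝ] E4) (E4.basisVector 0)) 0 ≤ γ) ∧
      Differentiable ℝ (fun t ↦ ((Λ t : E4 ≃L[ℝ] E4) (E4.basisVector 0)) 0) ∧
      ∃ T₁ : ℝ, ∀ t t', T₁ ≤ t → T₁ ≤ t' →
        |((Λ t : E4 ≃L[ℝ] E4) (E4.basisVector 0)) 0 - ((Λ t' : E4 ≃L[ℝ] E4) (E4.basisVector 0)) 0| ≤
          1 * |t - t'| := by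
  have hu1 : ∀ t, 1 ≤ ((Λ t : E4 ≃L[ℝ] E4) (E4.basisVector 0)) 0 := fun t ↦ by
    have h := one_le_abs_lorentz_apply_zero (Λ t)
    rw [abs_of_pos (hpos t)] at h; exact h
  have huγ' : ∀ t, ((Λ t : E4 ≃L[ℝ] E4) (E4.basisVector 0)) 0 ≤ γ := fun t ↦ by
    have h := huγ t; rw [abs_of_pos (hpos t)] at h; exact h
  have hcd : ContDiff ℝ ∞ (fun t ↦ ((Λ t : E4 ≃L[ℝ] E4) (E4.basisVector 0)) 0) := contDiff_frameVel_zero Λ hΛ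
  have hud : Differentiable ℝ (fun t ↦ ((Λ t : E4 ≃L[ℝ] E4) (E4.basisVector 0)) 0) :=
    hcd.differentiable (by simp)
  -- `deriv ũ⁰ → 0`
  have hd1 : Tendsto (deriv fun t ↦ ((Λ t : E4 ≃L[ℝ] E4) (E4.basisVector 0)) 0) atTop (𝓝 0) := by
    have h := tendsto_iteratedDeriv_frameVel Λ hΛ hdec 1 le_rfl (by norm_num)
    have h' := ((EuclideanSpace.proj (0 : Fin 4) : E4 →L[ℝ] ℝ).continuous.tendsto 0).comp h
    rw [map_zero] at h'
    refine h'.congr fun t ↦ ?_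
    show (iteratedDeriv 1 (fun s ↦ frameVel (Λ s)) t) 0 = _
    rw [← iteratedDeriv_frameVel_zero Λ hΛ 1 t, iteratedDeriv_one]
    rfl
  obtain ⟨T₁, hT₁⟩ := exists_lipschitz_of_tendsto_deriv hud hd1
  exact ⟨hu1, huγ', hud, T₁, hT₁⟩

/-- Registered one-line form (stub `sqrt_sq_sub_one_le_of_abs_le_rechart` of the crux item) of
`sqrt_sq_sub_one_le_of_abs_le`. [folklore] -/
theorem sqrt_sq_sub_one_le_of_abs_le_rechart : ∀ {u γ : ℝ}, |u| ≤ γ → Real.sqrt (u ^ 2 - 1) ≤ γ :=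
  fun h ↦ sqrt_sq_sub_one_le_of_abs_le h

end Summit.FinalStateConjecture.FinalStateConjecture.Theorems
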